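import Summits.CriticalPhenomena.Ising3DConformalLimit.Theses.SubPtolemyInterlacing
import Literature.Probability.LatticeModels.CriticalUrsellFourSign
import Literature.Probability.LatticeModels.CriticalAxisRatioRegularity
import HarnessLib

/-!
# Line `Sketch` for the crux `SubPtolemyInterlacing.Interlacing` (stmt-CriticalPhenomena-15702) — helpers `stub_patternForm`, `stub_boxSPC_of_patternIneq`

The one-measure (pairing-pattern) form of the engine: the three box pairing identities and their consequence.

Helper file of the line `Sketch` (lead skeleton `Cruxes/Interlacing/Lines/Sketch.lean`): proves the registered helpers
`stub_patternForm`, `stub_boxSPC_of_patternIneq` verbatim (name + signature). No definitions, no named facts, no sorry.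
-/

noncomputable section

namespace Summit.CriticalPhenomena.Ising3DConformalLimit.Cruxes.Interlacing.Sketch

open Filter MeasureTheory
open scoped symmDiff Topology
open Literature.Probability.LatticeModels Literature.Probability.Percolation

/-- Axis points `Pi.single 0 k` with `k ≤ L` lie in the box `Λ_L`. -/
private theorem single_mem_box {L k : ℕ} (hk : k ≤ L) : (Pi.single 0 ((k : ℕ) : ℤ) : Site 3) ∈ box 3 L := by
  rw [mem_box]
  intro i
  by_cases hi : i = 0
  · subst hi
    simp only [Pi.single_eq_same]
    omega
  · simp [hi]

/-- `σ_{x₁}σ_{x₂}σ_{x₃}σ_{x₄} = σ_{({x₁}∆{x₂})∆({x₃}∆{x₄})}` (`σ² = 1`; no distinctness needed). -/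
private theorem spinMonomial_four_eq_spinProduct (x₁ x₂ x₃ x₄ : Site 3) :
    spinMonomial ![x₁, x₂, x₃, x₄] =
      spinProduct (((({x₁} : Finset (Site 3)) ∆ {x₂}) ∆ ({x₃} ∆ {x₄}))) := by
  funext s
  rw [← spinProduct_mul_eq_spinProduct_symmDiff]
  have h12 := congrFun (spinPair_eq_spinProduct_symmDiff (V := Site 3) x₁ x₂) s
  have h34 := congrFun (spinPair_eq_spinProduct_symmDiff (V := Site 3) x₃ x₄) s
  rw [← h12, ← h34]
  simp only [spinMonomial, spinPair, Fin.prod_univ_four, Matrix.cons_val_zero, Matrix.cons_val_one,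
    Matrix.cons_val]
  ring

/-- The box four-point expectation as a set correlation: `⟨σ_{x₁}σ_{x₂}σ_{x₃}σ_{x₄}⟩_L = ⟨σ_S⟩_L`,
`S = ({x₁}∆{x₂})∆({x₃}∆{x₄})`. -/
private theorem isingExpect_four_eq_isingCorr (L : ℕ) (x₁ x₂ x₃ x₄ : Site 3) :
    isingExpect (zdGraph 3) (box 3 L) (criticalBeta 3) 0 .free (spinMonomial ![x₁, x₂, x₃, x₄]) =
      isingCorr (zdGraph 3) (box 3 L) (criticalBeta 3) 0 .free ((({x₁} : Finset (Site 3)) ∆ {x₂}) ∆ ({x₃} ∆ {x₄})) := by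
  rw [isingCorr, spinMonomial_four_eq_spinProduct]

/-- The box two-point function as a set correlation: `⟨σ_xσ_y⟩_L = ⟨σ_{{x}∆{y}}⟩_L`. -/
private theorem isingTwoPoint_eq_isingCorr (L : ℕ) (x y : Site 3) :
    isingTwoPoint (zdGraph 3) (box 3 L) (criticalBeta 3) 0 .free x y =
      isingCorr (zdGraph 3) (box 3 L) (criticalBeta 3) 0 .free (({x} : Finset (Site 3)) ∆ {y}) := by
  rw [isingTwoPoint, spinPair_eq_spinProduct_symmDiff, ← isingCorr]

/-- **One pairing identity** (ADC21 (3.10) in the box, pair form): for box points `x, y, u, v`,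
`⟨σ_xσ_y⟩_L ⟨σ_uσ_v⟩_L = ⟨σ_xσ_yσ_uσ_v⟩_L · 𝐏^{({x}∆{y})∆({u}∆{v}),∅}_{Λ_L}[u ↔ v]`. -/
private theorem pairing_identity (L : ℕ) {x y u v : Site 3} (hx : x ∈ box 3 L) (hy : y ∈ box 3 L)
    (hu : u ∈ box 3 L) (hv : v ∈ box 3 L) :
    isingTwoPoint (zdGraph 3) (box 3 L) (criticalBeta 3) 0 .free x y *
        isingTwoPoint (zdGraph 3) (box 3 L) (criticalBeta 3) 0 .free u v =
      isingCorr (zdGraph 3) (box 3 L) (criticalBeta 3) 0 .free ((({x} : Finset (Site 3)) ∆ {y}) ∆ ({u} ∆ {v})) *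
        (sourcedDoubleCurrentLaw 3 L (criticalBeta 3) ((({x} : Finset (Site 3)) ∆ {y}) ∆ ({u} ∆ {v})) ∅).real
          (openConn u v) := by
  rw [isingTwoPoint_eq_isingCorr L x y]
  exact isingCorr_free_box_mul_twoPoint_eq (d := 3) L (criticalBeta_nonneg 3)
    (symmDiff_singleton_subset_box (d := 3) hx hy) hu hv

/-- **Helper `stub_patternForm` (the three box pairing identities, ADC21 (3.10) in `Λ_L`).** For the axis
quadruple `x₁ = 0, x₂ = a e₁, x₃ = (a+b) e₁, x₄ = (a+b+c) e₁` in the free box `Λ_L` at `β_c` and the ONE box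
double current `𝐏 := 𝐏^{S,∅}_{Λ_L}`, `S = ({x₁}∆{x₂})∆({x₃}∆{x₄})` (four sources for the first current, none
for the second): `P₁ᴸ = S₄ᴸ·𝐏[x₃ ↔ x₄]`, `P₂ᴸ = S₄ᴸ·𝐏[x₂ ↔ x₄]`, `P₃ᴸ = S₄ᴸ·𝐏[x₂ ↔ x₃]` — the tree's
`isingCorr_free_box_mul_twoPoint_eq` three times, with `σ² = 1` bookkeeping. No distinctness of the points is
needed. Consequence (`boxSPC_of_patternIneq`): box SPC ⟸ `𝐏[x₂ ↔ x₄] ≤ 𝐏[x₃ ↔ x₄]·𝐏[x₂ ↔ x₃]`, the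
one-measure ("pattern") form `r×(1+q) ≤ r∥·r⊃` of the engine. -/
theorem stub_patternForm : ∀ L a b c : ℕ, a + b + c ≤ L →
    (isingTwoPoint (zdGraph 3) (box 3 L) (criticalBeta 3) 0 .free (Pi.single 0 ((0 : ℕ) : ℤ)) (Pi.single 0 ((a : ℕ) : ℤ)) *
            isingTwoPoint (zdGraph 3) (box 3 L) (criticalBeta 3) 0 .free (Pi.single 0 ((a + b : ℕ) : ℤ)) (Pi.single 0 ((a + b + c : ℕ) : ℤ)) =
        isingExpect (zdGraph 3) (box 3 L) (criticalBeta 3) 0 .free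
          (spinMonomial ![(Pi.single 0 ((0 : ℕ) : ℤ)), (Pi.single 0 ((a : ℕ) : ℤ)), (Pi.single 0 ((a + b : ℕ) : ℤ)), (Pi.single 0 ((a + b + c : ℕ) : ℤ))]) *
        (sourcedDoubleCurrentLaw 3 L (criticalBeta 3) (({(Pi.single 0 ((0 : ℕ) : ℤ))} ∆ {(Pi.single 0 ((a : ℕ) : ℤ))}) ∆ ({(Pi.single 0 ((a + b : ℕ) : ℤ))} ∆ {(Pi.single 0 ((a + b + c : ℕ) : ℤ))})) ∅).real
          (openConn (Pi.single 0 ((a + b : ℕ) : ℤ)) (Pi.single 0 ((a + b + c : ℕ) : ℤ)))) ∧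
      (isingTwoPoint (zdGraph 3) (box 3 L) (criticalBeta 3) 0 .free (Pi.single 0 ((0 : ℕ) : ℤ)) (Pi.single 0 ((a + b : ℕ) : ℤ)) *
            isingTwoPoint (zdGraph 3) (box 3 L) (criticalBeta 3) 0 .free (Pi.single 0 ((a : ℕ) : ℤ)) (Pi.single 0 ((a + b + c : ℕ) : ℤ)) =
        isingExpect (zdGraph 3) (box 3 L) (criticalBeta 3) 0 .free
          (spinMonomial ![(Pi.single 0 ((0 : ℕ) : ℤ)), (Pi.single 0 ((a : ℕ) : ℤ)), (Pi.single 0 ((a + b : ℕ) : ℤ)), (Pi.single 0 ((a + b + c : ℕ) : ℤ))]) *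
        (sourcedDoubleCurrentLaw 3 L (criticalBeta 3) (({(Pi.single 0 ((0 : ℕ) : ℤ))} ∆ {(Pi.single 0 ((a : ℕ) : ℤ))}) ∆ ({(Pi.single 0 ((a + b : ℕ) : ℤ))} ∆ {(Pi.single 0 ((a + b + c : ℕ) : ℤ))})) ∅).real
          (openConn (Pi.single 0 ((a : ℕ) : ℤ)) (Pi.single 0 ((a + b + c : ℕ) : ℤ)))) ∧
      (isingTwoPoint (zdGraph 3) (box 3 L) (criticalBeta 3) 0 .free (Pi.single 0 ((0 : ℕ) : ℤ)) (Pi.single 0 ((a + b + c : ℕ) : ℤ)) *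
            isingTwoPoint (zdGraph 3) (box 3 L) (criticalBeta 3) 0 .free (Pi.single 0 ((a : ℕ) : ℤ)) (Pi.single 0 ((a + b : ℕ) : ℤ)) =
        isingExpect (zdGraph 3) (box 3 L) (criticalBeta 3) 0 .free
          (spinMonomial ![(Pi.single 0 ((0 : ℕ) : ℤ)), (Pi.single 0 ((a : ℕ) : ℤ)), (Pi.single 0 ((a + b : ℕ) : ℤ)), (Pi.single 0 ((a + b + c : ℕ) : ℤ))]) *
        (sourcedDoubleCurrentLaw 3 L (criticalBeta 3) (({(Pi.single 0 ((0 : ℕ) : ℤ))} ∆ {(Pi.single 0 ((a : ℕ) : ℤ))}) ∆ ({(Pi.single 0 ((a + b : ℕ) : ℤ))} ∆ {(Pi.single 0 ((a + b + c : ℕ) : ℤ))})) ∅).real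
          (openConn (Pi.single 0 ((a : ℕ) : ℤ)) (Pi.single 0 ((a + b : ℕ) : ℤ)))) := by
  intro L a b c hL
  have h0 : (Pi.single 0 ((0 : ℕ) : ℤ) : Site 3) ∈ box 3 L := single_mem_box (Nat.zero_le L)
  have ha : (Pi.single 0 ((a : ℕ) : ℤ) : Site 3) ∈ box 3 L := single_mem_box (by omega)
  have hab : (Pi.single 0 ((a + b : ℕ) : ℤ) : Site 3) ∈ box 3 L := single_mem_box (by omega)
  have habc : (Pi.single 0 ((a + b + c : ℕ) : ℤ) : Site 3) ∈ box 3 L := single_mem_box hL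
  set x₁ : Site 3 := Pi.single 0 ((0 : ℕ) : ℤ) with hx₁
  set x₂ : Site 3 := Pi.single 0 ((a : ℕ) : ℤ) with hx₂
  set x₃ : Site 3 := Pi.single 0 ((a + b : ℕ) : ℤ) with hx₃
  set x₄ : Site 3 := Pi.single 0 ((a + b + c : ℕ) : ℤ) with hx₄
  rw [isingExpect_four_eq_isingCorr]
  refine ⟨pairing_identity L h0 ha hab habc, ?_, ?_⟩
  · have h := pairing_identity L h0 hab ha habc
    rwa [symmDiff_symmDiff_symmDiff_comm] at h
  · have h := pairing_identity L h0 habc ha hab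
    rwa [symmDiff_symmDiff_symmDiff_comm, symmDiff_comm ({x₄} : Finset (Site 3)) {x₃}] at h

/-- **Helper `stub_boxSPC_of_patternIneq` (the one-measure form implies box SPC).** If under the four-source box
double current `𝐏^{S,∅}_{Λ_L}` the interlaced pair event is dominated by the product of the two planar ones,
`𝐏[x₂ ↔ x₄] ≤ 𝐏[x₃ ↔ x₄]·𝐏[x₂ ↔ x₃]`, then the box interlacing inequality `S₄ᴸ P₂ᴸ ≤ P₁ᴸ P₃ᴸ` holds
(multiply by `(S₄ᴸ)² ≥ 0` and use `stub_patternForm`). This is the hypothesis-free, single-measure restatement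
of the engine (`r×·(1+q) ≤ r∥·r⊃` in pairing-pattern language). -/
theorem stub_boxSPC_of_patternIneq : ∀ L a b c : ℕ, a + b + c ≤ L →
    (sourcedDoubleCurrentLaw 3 L (criticalBeta 3) (({(Pi.single 0 ((0 : ℕ) : ℤ))} ∆ {(Pi.single 0 ((a : ℕ) : ℤ))}) ∆ ({(Pi.single 0 ((a + b : ℕ) : ℤ))} ∆ {(Pi.single 0 ((a + b + c : ℕ) : ℤ))})) ∅).real
          (openConn (Pi.single 0 ((a : ℕ) : ℤ)) (Pi.single 0 ((a + b + c : ℕ) : ℤ))) ≤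
      (sourcedDoubleCurrentLaw 3 L (criticalBeta 3) (({(Pi.single 0 ((0 : ℕ) : ℤ))} ∆ {(Pi.single 0 ((a : ℕ) : ℤ))}) ∆ ({(Pi.single 0 ((a + b : ℕ) : ℤ))} ∆ {(Pi.single 0 ((a + b + c : ℕ) : ℤ))})) ∅).real
          (openConn (Pi.single 0 ((a + b : ℕ) : ℤ)) (Pi.single 0 ((a + b + c : ℕ) : ℤ))) *
        (sourcedDoubleCurrentLaw 3 L (criticalBeta 3) (({(Pi.single 0 ((0 : ℕ) : ℤ))} ∆ {(Pi.single 0 ((a : ℕ) : ℤ))}) ∆ ({(Pi.single 0 ((a + b : ℕ) : ℤ))} ∆ {(Pi.single 0 ((a + b + c : ℕ) : ℤ))})) ∅).real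
          (openConn (Pi.single 0 ((a : ℕ) : ℤ)) (Pi.single 0 ((a + b : ℕ) : ℤ))) →
      isingExpect (zdGraph 3) (box 3 L) (criticalBeta 3) 0 .free
          (spinMonomial ![(Pi.single 0 ((0 : ℕ) : ℤ)), (Pi.single 0 ((a : ℕ) : ℤ)), (Pi.single 0 ((a + b : ℕ) : ℤ)), (Pi.single 0 ((a + b + c : ℕ) : ℤ))]) *
          (isingTwoPoint (zdGraph 3) (box 3 L) (criticalBeta 3) 0 .free (Pi.single 0 ((0 : ℕ) : ℤ)) (Pi.single 0 ((a + b : ℕ) : ℤ)) *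
            isingTwoPoint (zdGraph 3) (box 3 L) (criticalBeta 3) 0 .free (Pi.single 0 ((a : ℕ) : ℤ)) (Pi.single 0 ((a + b + c : ℕ) : ℤ))) ≤
        isingTwoPoint (zdGraph 3) (box 3 L) (criticalBeta 3) 0 .free (Pi.single 0 ((0 : ℕ) : ℤ)) (Pi.single 0 ((a : ℕ) : ℤ)) *
            isingTwoPoint (zdGraph 3) (box 3 L) (criticalBeta 3) 0 .free (Pi.single 0 ((a + b : ℕ) : ℤ)) (Pi.single 0 ((a + b + c : ℕ) : ℤ)) *
          (isingTwoPoint (zdGraph 3) (box 3 L) (criticalBeta 3) 0 .free (Pi.single 0 ((0 : ℕ) : ℤ)) (Pi.single 0 ((a + b + c : ℕ) : ℤ)) *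
            isingTwoPoint (zdGraph 3) (box 3 L) (criticalBeta 3) 0 .free (Pi.single 0 ((a : ℕ) : ℤ)) (Pi.single 0 ((a + b : ℕ) : ℤ))) := by
  intro L a b c hL hq
  obtain ⟨h1, h2, h3⟩ := stub_patternForm L a b c hL
  rw [h1, h2, h3]
  set S4 := isingExpect (zdGraph 3) (box 3 L) (criticalBeta 3) 0 .free
    (spinMonomial ![(Pi.single 0 ((0 : ℕ) : ℤ)), (Pi.single 0 ((a : ℕ) : ℤ)), (Pi.single 0 ((a + b : ℕ) : ℤ)),
      (Pi.single 0 ((a + b + c : ℕ) : ℤ))])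
  nlinarith [mul_le_mul_of_nonneg_left hq (mul_self_nonneg S4)]

end Summit.CriticalPhenomena.Ising3DConformalLimit.Cruxes.Interlacing.Sketch

end
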